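import Literature.NumberTheory.DiophantineGeometry.PlaneCurveFunctionFieldProofs
import Literature.NumberTheory.DiophantineGeometry.PlaneCurveGenusBoundProofs
import HarnessLib

/-!
# Weighted plane models: `w(y) ≤ max(1, w(x))ᵏ`, `y ∈ ℒ(k (x)_∞)` and `2g ≤ (d-1)(kd-2)`

Library file continuing `PlaneCurveFunctionFieldProofs` / `PlaneCurveGenusBoundProofs`. Those
files treat a plane model `Φ(x, y) = 0`, `Φ ∈ K[X][Y]` monic of degree `d` in `Y` and of *total*
degree `d`. Here the total-degree hypothesis is replaced by the weighted one

  `deg_X (coeff of Yⁱ in Φ) ≤ k (d - i)`  (`i < d`),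

i.e. `Φ` is a sum of monomials `Xᵃ Yⁱ` with `a + k i ≤ k d` (the Newton polygon lies under the
segment from `(0, d)` to `(kd, 0)`). This is the shape of the Artin–Schreier models
`Yᵖ - Q(X)ᵖ⁻¹ Y - P(X) Q(X)ᵖ⁻¹` (`deg P ≤ deg Q`, weight `k = deg Q`) used for Weil's bound on
exponential sums with rational argument. The three results are the weighted analogues, with the
same proofs:

* `valuation_le_max_pow_of_eval₂_eq_zero`: `w(y) ≤ max (1, w(x))ᵏ` for every valuation `w` of `F`
  trivial on `K` (ultrametric domination of `yᵈ`);
* `mem_riemannRochSpace_nsmul_negPart_of_aeval_eq_zero`: hence `y ∈ ℒ(k (x)_∞)`;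
* `two_mul_genus_le_of_planeModel_weighted`: if `F/K` has full constant field `K`,
  `[F : K(x)] = d`, `y ∈ ℒ(k (x)_∞)` and the monomials `xⁱ yʲ` (`j < d`) are `K`-linearly
  independent, then `2 g ≤ (d - 1)(k d - 2)`: the monomials `xⁱ yʲ` with `i + k j ≤ m`, `j < d`
  lie in `ℒ(m (x)_∞)`, so `ℓ(m (x)_∞) ≥ d(m+1) - k d(d-1)/2`, while `ℓ(m (x)_∞) = md + 1 - g` for
  `m` large (Riemann–Roch, Stichtenoth Thm. 1.4.11, 1.5.17).

(For `k = 1` these are the unweighted statements; the bound `(d-1)(kd-2)/2` is the genus of a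
smooth curve of type `(d, kd)` and is attained by the Artin–Schreier curves above when
`p ∤ deg`.) No definitions are introduced.

## References

* H. Stichtenoth, *Algebraic Function Fields and Codes*, 2nd ed., GTM 254, Springer 2009,
  Thm. 1.4.11, Thm. 1.5.17, Prop. 3.7.8 (genus of Artin–Schreier extensions). [Stichtenoth2009]
* W. M. Schmidt, *Equations over Finite Fields. An Elementary Approach*, LNM 536, Springer 1976,
  Ch. II §2, Ch. III. [Schmidt1976]
-/

noncomputable section

open scoped Classical Polynomial.Bivariate IntermediateField
open Polynomial

namespace Literature.NumberTheory.DiophantineGeometry.AlgFunctionField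

universe u

variable {K : Type u} [Field K]

section Valuation

variable {F : Type u} [Field F] [Algebra K F]

/-- **Weighted valuation inequality of a plane model.** Let `Φ ∈ K[X][Y]` be monic in `Y` of
degree `d` with `deg_X (coeff of Yⁱ) ≤ k (d - i)` for `i < d`, and let `Φ(x, y) = 0` in a field
`F ⊇ K`. Then `w(y) ≤ max (1, w(x))ᵏ` for every valuation `w` of `F` with `w ≤ 1` on `K`:
otherwise `yᵈ` strictly dominates every `aᵢ(x) yⁱ`, `i < d`. [folklore] -/
theorem valuation_le_max_pow_of_eval₂_eq_zero {Γ : Type*} [LinearOrderedCommGroupWithZero Γ]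
    (w : Valuation F Γ) (hK : ∀ c : K, w (algebraMap K F c) ≤ 1) {x y : F}
    {Φ : K[X][Y]} (hm : Φ.Monic) (k : ℕ)
    (hdeg : ∀ i, i < Φ.natDegree → (Φ.coeff i).natDegree ≤ k * (Φ.natDegree - i))
    (hΦ : Φ.eval₂ (aeval x : K[X] →ₐ[K] F).toRingHom y = 0) : w y ≤ max 1 (w x) ^ k := by
  set d := Φ.natDegree with hd
  set M := max 1 (w x) with hM
  by_contra hcon
  rw [not_le] at hcon
  have hM1 : 1 ≤ M := le_max_left _ _
  have hMk1 : 1 ≤ M ^ k := one_le_pow₀ hM1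
  have hy0 : 0 < w y := lt_of_lt_of_le (zero_lt_one.trans_le hMk1) hcon.le
  rw [eval₂_eq_sum_range, Finset.sum_range_succ, ← hd] at hΦ
  simp only [AlgHom.toRingHom_eq_coe, RingHom.coe_coe] at hΦ
  rw [show Φ.coeff d = 1 from hm.coeff_natDegree, map_one, one_mul] at hΦ
  have hyd : w (y ^ d) = w (∑ i ∈ Finset.range d, aeval x (Φ.coeff i) * y ^ i) := by
    rw [← Valuation.map_neg _ (∑ i ∈ Finset.range d, _), (neg_eq_of_add_eq_zero_right hΦ)]
  have hlt : w (∑ i ∈ Finset.range d, aeval x (Φ.coeff i) * y ^ i) < w y ^ d := by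
    refine Valuation.map_sum_lt _ (pow_ne_zero _ hy0.ne') fun i hi ↦ ?_
    rw [Finset.mem_range] at hi
    rw [map_mul, map_pow]
    have h1 : w (aeval x (Φ.coeff i)) ≤ (M ^ k) ^ (d - i) := by
      refine (valuation_aeval_le w hK x _).trans ?_
      rw [← pow_mul]
      exact pow_le_pow_right₀ hM1 (hdeg i hi)
    have h2 : (M ^ k) ^ (d - i) < w y ^ (d - i) := pow_lt_pow_left₀ hcon zero_le (by omega)
    calc w (aeval x (Φ.coeff i)) * w y ^ i ≤ (M ^ k) ^ (d - i) * w y ^ i :=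
          mul_le_mul' h1 le_rfl
      _ < w y ^ (d - i) * w y ^ i := mul_lt_mul_of_pos_right h2 (pow_pos hy0 _)
      _ = w y ^ d := by rw [← pow_add]; congr 1; omega
  rw [← hyd, map_pow] at hlt
  exact lt_irrefl _ hlt

variable [Algebra K[X] F] [Algebra (RatFunc K) F] [IsScalarTower K[X] (RatFunc K) F]
  [IsScalarTower K K[X] F]

/-- **`y ∈ ℒ(k (x)_∞)` on a weighted plane model.** If `Φ` is monic in `Y` of degree `d` with
`deg_X (coeff of Yⁱ) ≤ k (d - i)` for `i < d`, and `Φ(x, y) = 0` in an algebraic function field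
`F/K` (an algebra over `K[X] ⊆ K(X)`, `x` the image of `X`), then `y` has poles only at poles of
`x`, of order at most `k` times the order of the pole of `x`: `y ∈ ℒ(k (x)_∞)`. [folklore] -/
theorem mem_riemannRochSpace_nsmul_negPart_of_aeval_eq_zero [IsAlgFunctionField K F]
    {Φ : K[X][Y]} {y : F} (hΦ : aeval y (Φ.map (algebraMap K[X] (RatFunc K))) = 0)
    (hm : Φ.Monic) (k : ℕ)
    (hdeg : ∀ i, i < Φ.natDegree → (Φ.coeff i).natDegree ≤ k * (Φ.natDegree - i)) :
    y ∈ riemannRochSpace (k • (principalDivisor K (algebraMap K[X] F X))⁻) := by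
  set x : F := algebraMap K[X] F X with hx
  have hx0 : x ≠ 0 := algebraMap_X_ne_zero K F
  by_cases hy0 : y = 0
  · rw [hy0]; exact zero_mem _
  refine mem_riemannRochSpace_of_neg_apply_le_ord hy0 fun v ↦ ?_
  rw [Finsupp.smul_apply, Divisor.negPart_apply, principalDivisor_apply_of_ne_zero hx0,
    nsmul_eq_mul]
  have hK : ∀ c : K, v.valuation (algebraMap K F c) ≤ 1 := fun c ↦
    v.toValuationSubring.valuation_le_one ⟨_, v.algebraMap_mem c⟩
  have key : v.valuation y ≤ max 1 (v.valuation x) ^ k :=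
    valuation_le_max_pow_of_eval₂_eq_zero v.valuation hK hm k hdeg
      (eval₂_aeval_algebraMap_X_eq_zero hΦ)
  by_cases hvx : v.valuation x ≤ 1
  · rw [max_eq_left hvx, one_pow] at key
    have hyO : y ∈ v.toValuationSubring := (v.toValuationSubring.valuation_le_one_iff y).1 key
    rw [v.mem_toValuationSubring_iff_ord_nonneg hy0] at hyO
    have : 0 ≤ max (-v.ord x) 0 := le_max_right _ _
    nlinarith
  · rw [not_le] at hvx
    rw [max_eq_right hvx.le, ← map_pow] at key
    have hxk0 : x ^ k ≠ 0 := pow_ne_zero _ hx0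
    have hyx : y / x ^ k ∈ v.toValuationSubring := by
      rw [← v.toValuationSubring.valuation_le_one_iff, map_div₀]
      exact div_le_one_of_le₀ key zero_le
    rw [v.mem_toValuationSubring_iff_ord_nonneg (div_ne_zero hy0 hxk0), v.ord_div hy0 hxk0,
      v.ord_pow hx0] at hyx
    have hordx : v.ord x < 0 := (v.one_lt_valuation_iff_ord_neg hx0).1 hvx
    have : max (-v.ord x) 0 = -v.ord x := max_eq_left (by omega)
    rw [this]
    nlinarith

end Valuation

/-! ### The weighted genus bound -/

section Genus

universe v

variable {F : Type v} [Field F] [Algebra K F]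

/-- The arithmetic behind the weighted triangle count:
`2 ∑_{j<d} (m + 1 - k j) + k d(d-1) = 2d(m+1)` for `k (d - 1) ≤ m + 1`. [folklore] -/
theorem two_mul_sum_range_sub_mul_add (d m k : ℕ) (hdm : k * (d - 1) ≤ m + 1) :
    2 * ∑ j ∈ Finset.range d, (m + 1 - k * j) + k * (d * (d - 1)) = 2 * (d * (m + 1)) := by
  have h1 : ∑ j ∈ Finset.range d, (m + 1 - k * j) + k * ∑ j ∈ Finset.range d, j
      = d * (m + 1) := by
    rw [Finset.mul_sum, ← Finset.sum_add_distrib]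
    have : ∀ j ∈ Finset.range d, (m + 1 - k * j) + k * j = m + 1 := fun j hj ↦ by
      rw [Finset.mem_range] at hj
      have : k * j ≤ k * (d - 1) := Nat.mul_le_mul_left k (by omega)
      omega
    rw [Finset.sum_congr rfl this, Finset.sum_const, Finset.card_range, smul_eq_mul]
  have h2 : (∑ j ∈ Finset.range d, j) * 2 = d * (d - 1) := Finset.sum_range_id_mul_two d
  have h3 : k * (d * (d - 1)) = 2 * (k * ∑ j ∈ Finset.range d, j) := by
    rw [← h2]; ring
  omega

/-- **Genus bound for a weighted plane model: `2g ≤ (d-1)(kd-2)`.** Let `F/K` be an algebraic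
function field of one variable with full constant field `K`, `x ∈ F` transcendental over `K` with
`[F : K(x)] = d`, and `y ∈ ℒ(k (x)_∞)` such that for every `l` the monomials `xⁱ yʲ` (`i ≤ l`,
`j < d`) are linearly independent over `K`. Then `2 g ≤ (d-1)(kd-2)` where `g` is the genus of
`F/K`. Proof: the monomials `xⁱ yʲ` with `i + k j ≤ m`, `j < d` lie in `ℒ(m (x)_∞)`, so
`ℓ(m (x)_∞) ≥ d(m+1) - k d(d-1)/2`, and `ℓ(m (x)_∞) = md + 1 - g` for `m` large by Riemann–Roch
(Stichtenoth Thm. 1.4.11 for `deg (x)_∞ = d`, Thm. 1.5.17).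
[cite: Stichtenoth2009, Thm. 1.4.11 and Thm. 1.5.17] -/
theorem two_mul_genus_le_of_planeModel_weighted [IsAlgFunctionField K F]
    [IsIntegrallyClosedIn K F] {x y : F} (hx : Transcendental K x) {d : ℕ}
    (hd : Module.finrank K⟮x⟯ F = d) (k : ℕ)
    (hy : y ∈ riemannRochSpace (k • (principalDivisor K x)⁻))
    (hli : ∀ l : ℕ, LinearIndependent K
      fun ij : Fin (l + 1) × Fin d ↦ x ^ (ij.1 : ℕ) * y ^ (ij.2 : ℕ)) :
    2 * genus K F ≤ (d - 1) * (k * d - 2) := by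
  classical
  have hx0 : x ≠ 0 := fun h ↦ hx (h ▸ isAlgebraic_zero)
  haveI := IsAlgFunctionField.finiteDimensional_adjoin_simple hx
  -- `d ≥ 1`
  have hd1 : 1 ≤ d := by
    rw [← hd]
    exact Module.finrank_pos
  set A : Divisor K F := (principalDivisor K x)⁻ with hA
  have hA0 : 0 ≤ A := negPart_nonneg _
  have hdegA : A.degree = d := by
    rw [hA, degree_negPart_principalDivisor_eq hx, hd]
  have hxA : x ∈ riemannRochSpace A := mem_riemannRochSpace_negPart_principalDivisor hx0
  set g : ℕ := genus K F with hg
  -- the multiple `m A` used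
  set m : ℕ := 2 * g + k * d with hm
  have hdm : k * (d - 1) ≤ m + 1 := by
    have : k * (d - 1) ≤ k * d := Nat.mul_le_mul_left k (Nat.sub_le d 1)
    omega
  haveI := finiteDimensional_riemannRochSpace_of_isAlgFunctionField (K := K) (m • A)
  -- the weighted triangle family `xⁱ yʲ`, `j < d`, `i + k j ≤ m`
  let ι : Type := Σ j : Fin d, Fin (m + 1 - k * j)
  let e : ι → Fin (m + 1) × Fin d := fun ji ↦ (⟨ji.2, by have := ji.2.2; omega⟩, ji.1)
  have he : Function.Injective e := by
    rintro ⟨j, i⟩ ⟨j', i'⟩ h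
    simp only [e, Prod.mk.injEq, Fin.mk.injEq] at h
    obtain ⟨hi, rfl⟩ := h
    congr 1
    exact Fin.ext hi
  have hmem : ∀ ji : ι, x ^ ((e ji).1 : ℕ) * y ^ ((e ji).2 : ℕ) ∈ riemannRochSpace (m • A) := by
    rintro ⟨j, i⟩
    have hij : (i : ℕ) + k * j ≤ m := by have := i.2; omega
    have h1 : x ^ (i : ℕ) * y ^ (j : ℕ) ∈ riemannRochSpace ((i : ℕ) • A + (j : ℕ) • (k • A)) :=
      mul_mem_riemannRochSpace_add (pow_mem_riemannRochSpace_nsmul hxA i)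
        (pow_mem_riemannRochSpace_nsmul hy j)
    have hle : (i : ℕ) • A + (j : ℕ) • (k • A) ≤ m • A := by
      rw [← mul_nsmul, ← add_nsmul]
      exact nsmul_le_nsmul_left hA0 hij
    exact riemannRochSpace_mono hle h1
  have hliι : LinearIndependent K fun ji : ι ↦ x ^ ((e ji).1 : ℕ) * y ^ ((e ji).2 : ℕ) :=
    (hli m).comp e he
  have hli' : LinearIndependent K fun ji : ι ↦
      (⟨x ^ ((e ji).1 : ℕ) * y ^ ((e ji).2 : ℕ), hmem ji⟩ : riemannRochSpace (m • A)) :=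
    LinearIndependent.of_comp (riemannRochSpace (m • A)).subtype hliι
  have hcard := hli'.fintype_card_le_finrank
  have hcardι : Fintype.card ι = ∑ j ∈ Finset.range d, (m + 1 - k * j) := by
    simp only [ι, Fintype.card_sigma, Fintype.card_fin]
    exact Fin.sum_univ_eq_sum_range (fun j ↦ m + 1 - k * j) d
  -- so `∑_{j<d} (m+1-kj) ≤ ℓ(mA)`
  have hell : ∑ j ∈ Finset.range d, (m + 1 - k * j) ≤ ell (m • A) := by
    rw [← hcardι]
    exact hcard
  -- Riemann–Roch for `m A`: `deg (mA) = m d > 2g - 2`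
  have hdegmA : (m • A).degree = (m : ℤ) * d := by
    rw [map_nsmul, hdegA, nsmul_eq_mul]
  have hlt : 2 * (genus K F : ℤ) - 2 < (m • A).degree := by
    rw [hdegmA, hm]
    push_cast
    nlinarith
  have hRR := ell_eq_degree_add_one_sub_genus (K := K) (F := F) hlt
  rw [hdegmA] at hRR
  -- arithmetic
  have hsum := two_mul_sum_range_sub_mul_add d m k hdm
  have hell' : (2 * ∑ j ∈ Finset.range d, (m + 1 - k * j) : ℕ) ≤ 2 * ell (m • A) :=
    Nat.mul_le_mul_left 2 hell
  have hineq : 2 * (d * (m + 1)) ≤ 2 * ell (m • A) + k * (d * (d - 1)) := by omega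
  have hineqZ : (2 * ((d : ℤ) * (m + 1)) : ℤ) ≤
      2 * (ell (m • A) : ℤ) + k * (d * ((d : ℤ) - 1)) := by
    have h := (Nat.cast_le (α := ℤ)).2 hineq
    push_cast [Nat.cast_sub hd1] at h
    linarith
  have key : 2 * (g : ℤ) ≤ ((d : ℤ) - 1) * (k * (d : ℤ) - 2) := by
    rw [← hg] at hRR
    nlinarith
  rcases Nat.lt_or_ge (k * d) 2 with hkd | hkd
  · -- then `(d-1)(kd-2) ≤ 0` over `ℤ`, forcing `g = 0`
    have hneg : ((d : ℤ) - 1) * (k * (d : ℤ) - 2) ≤ 0 := by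
      apply mul_nonpos_of_nonneg_of_nonpos
      · have := (Nat.cast_le (α := ℤ)).2 hd1; push_cast at this; linarith
      · have := (Nat.cast_lt (α := ℤ)).2 hkd; push_cast at this; linarith
    have : g = 0 := by omega
    omega
  · have h2 : ((d - 1 : ℕ) : ℤ) = (d : ℤ) - 1 := by push_cast [Nat.cast_sub hd1]; ring
    have h3 : ((k * d - 2 : ℕ) : ℤ) = k * (d : ℤ) - 2 := by push_cast [Nat.cast_sub hkd]; ring
    have : (2 * g : ℤ) ≤ ((d - 1 : ℕ) : ℤ) * ((k * d - 2 : ℕ) : ℤ) := by rw [h2, h3]; exact key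
    exact_mod_cast this

end Genus

end Literature.NumberTheory.DiophantineGeometry.AlgFunctionField
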